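import Summits.ResolutionOfSingularities.ResolutionOfSingularities.Theorems.WeightedInvariantDatumToEmbedded
import Summits.ResolutionOfSingularities.ResolutionOfSingularities.Theorems.WeightedInvariantDatumToResolution
import HarnessLib

/-!
# Crux `WeightedThesis` (stmt-ResolutionOfSingularities-0569): the residue is FIELD-WISE Bergh–Rydh

Topic: `Summits/ResolutionOfSingularities/ResolutionOfSingularities/Theorems`. Route
`ResolutionOfSingularities/WeightedInvariant`, crux `Theses.WeightedInvariant.WeightedThesis` (resolution
of every reduced separated scheme of finite type over every PERFECT field of characteristic `p`, every
prime `p`), line `datum-glued-split`, lead c6 (RESHAPE 6).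

RESHAPE 5 (lead c4, `Theorems/WeightedInvariantWeightedThesisOfBerghRydh.lean`) pinned the crux on the
construction crux `WeightedConstruction` (stmt-0571) and ONE named fact, Bergh–Rydh 2019 Thm 5 in its
étale-local diagonalizable form `BerghRydh2019_diagonalizableQuotientResolution`
(`Literature/…/TameQuotientSingularitiesResolution.lean`), quantified over ALL perfect fields; its
converse `berghRydh2019_of_hironaka_of_weightedThesis` therefore needed Hironaka's theorem for the
characteristic-`0` instances of the fact, which the line never consumes.

This file cuts the named fact down to what the cobordant tower actually uses — Bergh–Rydh over the ONE
perfect ground field `k` of the pair being resolved — and records the exact residue FIELD BY FIELD, with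
no third named fact:

* `hasResolution_quotient_of_gradedAtlas_field` — the induction of
  `DatumToEmbedded.hasResolution_quotient_of_gradedAtlas` (Włodarczyk's global cobordant tower, torus
  quotient presented by graded atlases, the quotient of each cobordant blow-up realised as a blow-up
  downstairs) re-run with the Bergh–Rydh hypothesis restricted to `k`-schemes: every torus-quotient
  presentation of an integral closed subscheme of a smooth separated quasi-compact `Y/k` has a resolved
  quotient;
* `hasResolution_closedImmersion_of_datum_field` — hence a datum in characteristic `p` plus Bergh–Rydh
  over `k` resolve every integral closed subscheme of every smooth separated quasi-compact `k`-scheme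
  (the FIELD-WISE form of crux stmt-0572 `DatumToEmbedded`);
* `hasResolution_of_datum_field` — and every reduced separated `k`-scheme of finite type (projective
  reduction `hasResolution_of_forall_closedImmersion_smooth`: components + Chow + coborder factorisation);
* `berghRydh_field_of_resolution_field` — conversely, resolution of all reduced separated finite-type
  `k`-schemes trivially contains Bergh–Rydh over `k` (its quotient charts are not used);
* `resolution_field_iff_berghRydh_field_of_datum` — so, GIVEN a datum in characteristic `p = char k`,
  resolution over the perfect field `k` is EQUIVALENT to Bergh–Rydh's theorem over `k`;
* `weightedThesis_iff_forall_berghRydh_charP` — and, granted `WeightedConstruction`, the crux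
  `WeightedThesis` is equivalent to the characteristic-`p` instances of Bergh–Rydh for all primes `p`
  (Hironaka-free sharpening of `weightedThesis_iff_berghRydh2019`);
* `datumToEmbedded_of_forall_berghRydh_charP`, `weightedThesis_of_forall_berghRydh_charP` — the
  route items `DatumToEmbedded` (stmt-0572) and `WeightedThesis` (with `WeightedConstruction`) from
  the characteristic-`p` instances of Bergh–Rydh alone; the recorded named fact (all perfect fields)
  specialises to these instances trivially, recovering `datumToEmbedded_of_berghRydh2019` and
  `weightedThesis_of_berghRydh2019`.

All statements are sorry-free and carry their hypotheses in the signature (the Bergh–Rydh hypothesis is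
spelled out, not abbreviated, so that no new definition is introduced).
-/

noncomputable section

open CategoryTheory CategoryTheory.Limits AlgebraicGeometry TopologicalSpace
open Literature.AlgebraicGeometry.Resolution
open Summit.ResolutionOfSingularities.ResolutionOfSingularities.Theses.WeightedInvariant
open Summit.ResolutionOfSingularities.ResolutionOfSingularities.Theorems

set_option linter.dupNamespace false -- mandated namespace of this single-conjunct summit

namespace Summit.ResolutionOfSingularities.ResolutionOfSingularities.Theorems.WeightedThesis.BerghRydhCharP

/-! ## The tower with Bergh–Rydh over one field -/

/-- **Every torus-quotient presentation of an integral closed subscheme of `Y/k` has a resolved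
quotient, granted Bergh–Rydh over `k`**: the well-founded induction on `max inv` of
`DatumToEmbedded.hasResolution_quotient_of_gradedAtlas` (base: `X` regular ⇒ the quotient has finite
diagonalizable quotient singularities étale-locally, `DatumToEmbedded.quotientSingularities_of_regular`,
resolved by the hypothesis; step: global cobordant blow-up, `DatumToEmbedded.quotientStep`, transport
along the blow-up downstairs), with the named fact `BerghRydh2019_diagonalizableQuotientResolution`
replaced by its instances over the fixed perfect ground field `k` — the only instances the induction
consumes, since every pair of the tower lives over `k`.
[cite: Wlodarczyk2022, Thm 1.1.4 (5), Thm 1.1.6; BerghRydh2019, Thm 5] -/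
theorem hasResolution_quotient_of_gradedAtlas_field
    {p : ℕ} (D : WeightedResolutionDatum p) {k : Type} [Field k] [CharP k p] [PerfectField k]
    (hBR : ∀ (V : Scheme.{0}) (g : V ⟶ Spec (.of k)) [IsIntegral V] [IsSeparated g]
      [LocallyOfFiniteType g] [QuasiCompact g],
      (∀ v : V, ∃ (A : Type) (_ : AddCommGroup A) (_ : Finite A) (_ : DecidableEq A)
        (S : Type) (_ : CommRing S) (_ : Algebra k S) (𝒮 : A → Submodule k S)
        (_ : GradedAlgebra 𝒮), Algebra.FiniteType k S ∧ Algebra.Smooth k S ∧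
        ∃ φ : Spec (.of (𝒮 0)) ⟶ V, Etale φ ∧ v ∈ Set.range φ ∧
          φ ≫ g = Spec.map (CommRingCat.ofHom (algebraMap k (𝒮 0)))) →
      Scheme.HasResolution V)
    (Y : Scheme.{0}) (f : Y ⟶ Spec (.of k)) [Smooth f] [IsSeparated f] [QuasiCompact f]
    (I : Y.IdealSheafData) :
    ∀ (X V : Scheme.{0}) (i : X ⟶ Y) [IsClosedImmersion i] [IsIntegral X], i.ker = I →
      ∀ (g : V ⟶ Spec (.of k)) [IsSeparated g] [LocallyOfFiniteType g] [QuasiCompact g]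
        [IsIntegral V] (q : X ⟶ V), q ≫ g = i ≫ f → ∀ (j : ℕ), GradedAtlas j f i q →
        Scheme.HasResolution V := by
  have key := WeightedResolutionDatum.maxinv_induction D
    (fun (Y : Scheme.{0}) (f : Y ⟶ Spec (.of k)) (I : Y.IdealSheafData) =>
      ∀ [Smooth f] [IsSeparated f] [QuasiCompact f] (X V : Scheme.{0}) (i : X ⟶ Y)
        [IsClosedImmersion i] [IsIntegral X], i.ker = I →
        ∀ (g : V ⟶ Spec (.of k)) [IsSeparated g] [LocallyOfFiniteType g] [QuasiCompact g]
          [IsIntegral V] (q : X ⟶ V), q ≫ g = i ≫ f → ∀ (j : ℕ), GradedAtlas j f i q →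
          Scheme.HasResolution V) ?base ?step Y f I
  · exact fun X V i _ _ hI g _ _ _ _ q hq j 𝒜 => key X V i hI g q hq j 𝒜
  · -- base: `inv` everywhere minimal ⇒ `X` regular ⇒ quotient singularities ⇒ Bergh–Rydh over `k`
    intro Y f _ _ _ I hbot _ _ _ X V i _ _ hI g _ _ _ _ q hq j 𝒜
    subst hI
    have hreg : Scheme.IsRegular X := (isRegular_iff_forall_isBot_inv D f i).mpr hbot
    exact hBR V g (DatumToEmbedded.quotientSingularities_of_regular f i q g hq hreg 𝒜)
  · -- step
    intro Y f _ _ _ I y₀ hy₀ hmax ih _ _ _ X V i _ _ hI g _ _ _ _ q hq j 𝒜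
    subst hI
    have hguard : ∃ y : Y, ¬ IsBot (D.inv f i.ker y) := ⟨y₀, hy₀⟩
    -- the Rees filtration of the datum's centre
    let R' : ReesFiltration Y :=
      { ideal := (D.centre f i.ker).piece
        ideal_zero := (D.centre f i.ker).piece_zero
        antitone := antitone_piece (D.isRegularWeightedCentre_centre f i.ker hguard)
        mul_le := (D.centre f i.ker).piece_mul_le }
    -- the new ambient is smooth separated quasi-compact
    obtain ⟨hsm', hsep', hqc'⟩ :=
      WeightedThesis.GlobalCobordantPlus.stub_smooth_globalCobordantPlus D f i.ker hguard R' rfl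
    haveI := hsm'; haveI := hsep'; haveI := hqc'
    -- the strict transform is integral and lies over `X`
    obtain ⟨hint', hker⟩ := DatumToEmbedded.StrictTransform.stub_strictTransform D f i hguard R' rfl
    haveI := hint'
    set I' := R'.strictTransformPlus i.ker with hI'
    let i' := I'.subschemeι
    let σX : I'.subscheme ⟶ X := IsClosedImmersion.lift i (i' ≫ R'.πPlus) hker
    have hσX : σX ≫ i = i' ≫ R'.πPlus := IsClosedImmersion.lift_fac _ _ _
    -- homogeneity of the centre on the charts, then the quotient step
    have hhom := fun (a : 𝒜.ι) (n : ℕ) =>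
      @DatumToEmbedded.CentreHomogeneous.stub_centre_isHomogeneous p D k _ _ _ Y f _ _ _ i.ker hguard j (𝒜.W a)
        (𝒜.piece a) (𝒜.gradedRing a) (𝒜.appLE_mem a) (𝒜.isHomogeneous_ker a) n
    obtain ⟨K, hK, hstep⟩ := DatumToEmbedded.quotientStep D f i q g hq 𝒜 hguard hhom R' rfl σX hσX
    -- blow `V` up along `K`
    obtain ⟨V', ρ, hρ⟩ := exists_isBlowup V K
    haveI : IsLocallyNoetherian V := LocallyOfFiniteType.isLocallyNoetherian g
    haveI : IsProper ρ := hρ.isProper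
    have hbir : IsBirational ρ := hρ.isBirational' hK
    haveI : IsIntegral V' := hρ.isIntegral hK
    obtain ⟨q', hq', ⟨𝒜'⟩⟩ := hstep V' ρ hρ
    -- the induction hypothesis resolves `V'`
    have hdrop := DatumToEmbedded.InvDrop.stub_inv_drop D f i.ker hguard y₀ hmax R' rfl
    have hV' : Scheme.HasResolution V' := by
      have hQ' := ih (R'.plus : Scheme.{0}) (R'.πPlus ≫ f) I' hdrop
      refine hQ' I'.subscheme V' i' (Scheme.IdealSheafData.ker_subschemeι I') (ρ ≫ g) q' ?_
        (j + 1) 𝒜'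
      rw [← Category.assoc, hq', Category.assoc, hq, ← Category.assoc, hσX, Category.assoc]
    exact Scheme.HasResolution.of_isBirational ρ hbir hV'

/-! ## Datum + Bergh–Rydh over `k` ⇒ resolution over `k` -/

/-- **Field-wise `DatumToEmbedded`**: a weighted resolution datum in characteristic `p` together with
Bergh–Rydh's theorem over the perfect field `k` of characteristic `p` resolves every integral closed
subscheme `X` of every smooth separated quasi-compact `k`-scheme `Y` (run
`hasResolution_quotient_of_gradedAtlas_field` on the trivial presentation `q = 𝟙 X` of rank `0`,
`DatumToEmbedded.InitialAtlas.stub_initialAtlas`).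
[cite: Wlodarczyk2022, Thm 1.1.6; BerghRydh2019, Thm 5] -/
theorem hasResolution_closedImmersion_of_datum_field
    {p : ℕ} (D : WeightedResolutionDatum p) {k : Type} [Field k] [CharP k p] [PerfectField k]
    (hBR : ∀ (V : Scheme.{0}) (g : V ⟶ Spec (.of k)) [IsIntegral V] [IsSeparated g]
      [LocallyOfFiniteType g] [QuasiCompact g],
      (∀ v : V, ∃ (A : Type) (_ : AddCommGroup A) (_ : Finite A) (_ : DecidableEq A)
        (S : Type) (_ : CommRing S) (_ : Algebra k S) (𝒮 : A → Submodule k S)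
        (_ : GradedAlgebra 𝒮), Algebra.FiniteType k S ∧ Algebra.Smooth k S ∧
        ∃ φ : Spec (.of (𝒮 0)) ⟶ V, Etale φ ∧ v ∈ Set.range φ ∧
          φ ≫ g = Spec.map (CommRingCat.ofHom (algebraMap k (𝒮 0)))) →
      Scheme.HasResolution V)
    {Y X : Scheme.{0}} (f : Y ⟶ Spec (.of k)) [Smooth f] [IsSeparated f] [QuasiCompact f]
    (i : X ⟶ Y) [IsClosedImmersion i] [IsIntegral X] : Scheme.HasResolution X := by
  obtain ⟨𝒜₀⟩ := DatumToEmbedded.InitialAtlas.stub_initialAtlas f i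
  haveI : IsSeparated (i ≫ f) := inferInstance
  haveI : LocallyOfFiniteType (i ≫ f) := inferInstance
  haveI : QuasiCompact (i ≫ f) := inferInstance
  exact hasResolution_quotient_of_gradedAtlas_field D hBR Y f i.ker X X i rfl (i ≫ f) (𝟙 X)
    (Category.id_comp _) 0 𝒜₀

/-- **Field-wise `DatumToResolution`**: a weighted resolution datum in characteristic `p` together
with Bergh–Rydh's theorem over the perfect field `k` of characteristic `p` resolves every reduced
separated `k`-scheme of finite type (`hasResolution_closedImmersion_of_datum_field` spread by the
projective reduction `hasResolution_of_forall_closedImmersion_smooth`: irreducible components, Chow's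
lemma, coborder factorisation, transport along proper birational morphisms).
[cite: Wlodarczyk2022, Thm 1.1.6; BerghRydh2019, Thm 5; CossartPiltant2019, Prop. 4.6 (proof, Steps 1–3)] -/
theorem hasResolution_of_datum_field
    {p : ℕ} (D : WeightedResolutionDatum p) {k : Type} [Field k] [CharP k p] [PerfectField k]
    (hBR : ∀ (V : Scheme.{0}) (g : V ⟶ Spec (.of k)) [IsIntegral V] [IsSeparated g]
      [LocallyOfFiniteType g] [QuasiCompact g],
      (∀ v : V, ∃ (A : Type) (_ : AddCommGroup A) (_ : Finite A) (_ : DecidableEq A)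
        (S : Type) (_ : CommRing S) (_ : Algebra k S) (𝒮 : A → Submodule k S)
        (_ : GradedAlgebra 𝒮), Algebra.FiniteType k S ∧ Algebra.Smooth k S ∧
        ∃ φ : Spec (.of (𝒮 0)) ⟶ V, Etale φ ∧ v ∈ Set.range φ ∧
          φ ≫ g = Spec.map (CommRingCat.ofHom (algebraMap k (𝒮 0)))) →
      Scheme.HasResolution V)
    (X : Scheme.{0}) (f : X ⟶ Spec (.of k)) [IsSeparated f] [LocallyOfFiniteType f]
    [QuasiCompact f] [IsReduced X] : Scheme.HasResolution X :=
  hasResolution_of_forall_closedImmersion_smooth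
    (fun Y X' g i hg hs hq hi hint => by
      haveI := hg; haveI := hs; haveI := hq; haveI := hi; haveI := hint
      exact hasResolution_closedImmersion_of_datum_field D hBR g i) X f

/-! ## Conversely, and the field-wise / prime-wise residue -/

/-- **Resolution over `k` contains Bergh–Rydh over `k`**: an integral separated `k`-scheme of finite
type is reduced, so resolution of all reduced separated finite-type `k`-schemes resolves it; the étale
quotient charts of the Bergh–Rydh hypothesis are not used. [folklore] -/
theorem berghRydh_field_of_resolution_field {k : Type} [Field k]
    (h : ∀ (X : Scheme.{0}) (f : X ⟶ Spec (.of k)), IsSeparated f → LocallyOfFiniteType f →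
      QuasiCompact f → IsReduced X → Scheme.HasResolution X) :
    ∀ (V : Scheme.{0}) (g : V ⟶ Spec (.of k)) [IsIntegral V] [IsSeparated g]
      [LocallyOfFiniteType g] [QuasiCompact g],
      (∀ v : V, ∃ (A : Type) (_ : AddCommGroup A) (_ : Finite A) (_ : DecidableEq A)
        (S : Type) (_ : CommRing S) (_ : Algebra k S) (𝒮 : A → Submodule k S)
        (_ : GradedAlgebra 𝒮), Algebra.FiniteType k S ∧ Algebra.Smooth k S ∧
        ∃ φ : Spec (.of (𝒮 0)) ⟶ V, Etale φ ∧ v ∈ Set.range φ ∧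
          φ ≫ g = Spec.map (CommRingCat.ofHom (algebraMap k (𝒮 0)))) →
      Scheme.HasResolution V :=
  fun V g _ _ _ _ _ => h V g ‹_› ‹_› ‹_› inferInstance

/-- **The field-wise residue of the crux.** Over a perfect field `k` of characteristic `p` carrying a
weighted resolution datum `D : WeightedResolutionDatum p`, resolution of every reduced separated
`k`-scheme of finite type is EQUIVALENT to Bergh–Rydh's theorem over `k` (resolution of the integral
separated finite-type `k`-schemes covered by étale charts from quotients of smooth affine `k`-schemes
by finite diagonalizable group schemes): `→` forgets the charts, `←` is Włodarczyk's cobordant tower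
fed with `D` (`hasResolution_of_datum_field`). So at every prime the construction crux reduces the
resolution conjecture over each perfect field exactly to finite diagonalizable quotient singularities
over the same field. [cite: Wlodarczyk2022, Thm 1.1.6; BerghRydh2019, Thm 5] -/
theorem resolution_field_iff_berghRydh_field_of_datum : ∀ {p : ℕ} (D : Literature.AlgebraicGeometry.Resolution.WeightedResolutionDatum p) (k : Type) [Field k] [CharP k p] [PerfectField k], (∀ (X : AlgebraicGeometry.Scheme.{0}) (f : X ⟶ AlgebraicGeometry.Spec (.of k)), AlgebraicGeometry.IsSeparated f → AlgebraicGeometry.LocallyOfFiniteType f → AlgebraicGeometry.QuasiCompact f → AlgebraicGeometry.IsReduced X → Literature.AlgebraicGeometry.Resolution.Scheme.HasResolution X) ↔ ∀ (V : AlgebraicGeometry.Scheme.{0}) (g : V ⟶ AlgebraicGeometry.Spec (.of k)) [AlgebraicGeometry.IsIntegral V] [AlgebraicGeometry.IsSeparated g] [AlgebraicGeometry.LocallyOfFiniteType g] [AlgebraicGeometry.QuasiCompact g], (∀ v : V, ∃ (A : Type) (_ : AddCommGroup A) (_ : Finite A) (_ : DecidableEq A) (S : Type) (_ : CommRing S)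 (_ : Algebra k S) (𝒮 : A → Submodule k S) (_ : GradedAlgebra 𝒮), Algebra.FiniteType k S ∧ Algebra.Smooth k S ∧ ∃ φ : AlgebraicGeometry.Spec (.of (𝒮 0)) ⟶ V, AlgebraicGeometry.Etale φ ∧ v ∈ Set.range φ ∧ φ ≫ g = AlgebraicGeometry.Spec.map (CommRingCat.ofHom (algebraMap k (𝒮 0)))) → Literature.AlgebraicGeometry.Resolution.Scheme.HasResolution V :=
  fun D k _ _ _ =>
  ⟨berghRydh_field_of_resolution_field, fun hBR X f hs hl hq hr => by
    haveI := hs; haveI := hl; haveI := hq; haveI := hr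
    exact hasResolution_of_datum_field D hBR X f⟩

/-- **The crux modulo the construction crux is prime-wise Bergh–Rydh** (Hironaka-free sharpening of
`weightedThesis_iff_berghRydh2019`): granted `WeightedConstruction` (stmt-0571: a weighted resolution
datum exists in every prime characteristic), `WeightedThesis` holds iff, for every prime `p` and every
perfect field `k` of characteristic `p`, every integral separated finite-type `k`-scheme with finite
diagonalizable quotient singularities étale-locally admits a resolution — the characteristic-`p`
instances of Bergh–Rydh 2019 Thm 5, with no appeal to characteristic `0`. [cite: BerghRydh2019, Thm 5;
Wlodarczyk2022, Thm 1.1.6; AbramovichTemkinWlodarczyk2024, §1.9] -/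
theorem weightedThesis_iff_forall_berghRydh_charP : Summit.ResolutionOfSingularities.ResolutionOfSingularities.Theses.WeightedInvariant.WeightedConstruction → (Summit.ResolutionOfSingularities.ResolutionOfSingularities.Theses.WeightedInvariant.WeightedThesis ↔ ∀ p : ℕ, p.Prime → ∀ (k : Type) [Field k] [CharP k p] [PerfectField k], ∀ (V : AlgebraicGeometry.Scheme.{0}) (g : V ⟶ AlgebraicGeometry.Spec (.of k)) [AlgebraicGeometry.IsIntegral V] [AlgebraicGeometry.IsSeparated g] [AlgebraicGeometry.LocallyOfFiniteType g] [AlgebraicGeometry.QuasiCompact g], (∀ v : V, ∃ (A : Type) (_ : AddCommGroup A) (_ : Finite A) (_ : DecidableEq A) (S : Type) (_ : CommRing S) (_ : Algebra k S) (𝒮 : A → Submodule k S) (_ : GradedAlgebra 𝒮), Algebra.FiniteType k S ∧ Algebra.Smooth k S ∧ ∃ φ : AlgebraicGeometry.Spec (.of (𝒮 0)) ⟶ V, AlgebraicGeometry.Etale φ ∧ v ∈ Set.range φ ∧ φ ≫ g = AlgebraicGeometry.Spec.map (CommRingCat.ofHom (algebraMap k (𝒮 0)))) → Literature.AlgebraicGeometry.Resolution.Scheme.HasResolution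 V) := by
  intro hC
  constructor
  · intro hT p hp k _ _ _
    exact berghRydh_field_of_resolution_field (fun X f hs hl hq hr => hT p hp k X f hs hl hq hr)
  · intro hBR p hp k _ _ _ X f hs hl hq hr
    obtain ⟨D⟩ := hC p hp
    exact (resolution_field_iff_berghRydh_field_of_datum D k).mpr
      (fun V g _ _ _ _ hV => hBR p hp k V g hV) X f hs hl hq hr

/-- **Crux stmt-0572 `DatumToEmbedded` from prime-wise Bergh–Rydh** (sharpening of
`datumToEmbedded_of_berghRydh2019`, whose hypothesis is the named fact over ALL perfect fields): the
characteristic-`p` instances of Bergh–Rydh 2019 Thm 5, for every prime `p`, already give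
`DatumToEmbedded`, by `hasResolution_closedImmersion_of_datum_field` at the prime and field of the
pair. [cite: Wlodarczyk2022, Thm 1.1.6; BerghRydh2019, Thm 5] -/
theorem datumToEmbedded_of_forall_berghRydh_charP
    (hBR : ∀ p : ℕ, p.Prime → ∀ (k : Type) [Field k] [CharP k p] [PerfectField k]
      (V : Scheme.{0}) (g : V ⟶ Spec (.of k)) [IsIntegral V] [IsSeparated g]
      [LocallyOfFiniteType g] [QuasiCompact g],
      (∀ v : V, ∃ (A : Type) (_ : AddCommGroup A) (_ : Finite A) (_ : DecidableEq A)
        (S : Type) (_ : CommRing S) (_ : Algebra k S) (𝒮 : A → Submodule k S)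
        (_ : GradedAlgebra 𝒮), Algebra.FiniteType k S ∧ Algebra.Smooth k S ∧
        ∃ φ : Spec (.of (𝒮 0)) ⟶ V, Etale φ ∧ v ∈ Set.range φ ∧
          φ ≫ g = Spec.map (CommRingCat.ofHom (algebraMap k (𝒮 0)))) →
      Scheme.HasResolution V) :
    DatumToEmbedded := by
  intro p hp hD k _ _ _ Y X f i hf hsep hqc hi hint
  obtain ⟨D⟩ := hD
  haveI := hf; haveI := hsep; haveI := hqc; haveI := hi; haveI := hint
  exact hasResolution_closedImmersion_of_datum_field D (fun V g _ _ _ _ hV => hBR p hp k V g hV) f i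

/-- **The crux from the construction crux and prime-wise Bergh–Rydh** (the composition of line
`datum-glued-split`, RESHAPE 6, without the hypersurface detour): `WeightedConstruction` and the
characteristic-`p` instances of Bergh–Rydh for every prime `p` give `WeightedThesis`.
[cite: Wlodarczyk2022, Thm 1.1.6; BerghRydh2019, Thm 5] -/
theorem weightedThesis_of_forall_berghRydh_charP (hC : WeightedConstruction)
    (hBR : ∀ p : ℕ, p.Prime → ∀ (k : Type) [Field k] [CharP k p] [PerfectField k]
      (V : Scheme.{0}) (g : V ⟶ Spec (.of k)) [IsIntegral V] [IsSeparated g]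
      [LocallyOfFiniteType g] [QuasiCompact g],
      (∀ v : V, ∃ (A : Type) (_ : AddCommGroup A) (_ : Finite A) (_ : DecidableEq A)
        (S : Type) (_ : CommRing S) (_ : Algebra k S) (𝒮 : A → Submodule k S)
        (_ : GradedAlgebra 𝒮), Algebra.FiniteType k S ∧ Algebra.Smooth k S ∧
        ∃ φ : Spec (.of (𝒮 0)) ⟶ V, Etale φ ∧ v ∈ Set.range φ ∧
          φ ≫ g = Spec.map (CommRingCat.ofHom (algebraMap k (𝒮 0)))) →
      Scheme.HasResolution V) :
    WeightedThesis :=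
  (weightedThesis_iff_forall_berghRydh_charP hC).mpr hBR

end Summit.ResolutionOfSingularities.ResolutionOfSingularities.Theorems.WeightedThesis.BerghRydhCharP

end
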